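import Literature.NumberTheory.EllipticCurves.Kato2004.IwasawaCohomologyEulerSystemLift
import Literature.NumberTheory.GaloisRepresentations.ContinuousCorestrictionComp
import HarnessLib

/-!
# Kato 2004 §13.1 / Thm. 13.4: the Euler-system-to-`𝐇¹_Γ` lift with the corestriction-transitivity
# hypothesis DISCHARGED (`coresLe_comp`) — only integrality under corestriction remains displayed

Seat `bsd-potss-rkm` (cell `bsd-potss`, item stmt-BirchSwinnertonDyer-19196), step P1 (b) of the
realisation spec: `IwasawaH1Data.existsUnique_lift_of_isEulerSystem` (file
`IwasawaCohomologyEulerSystemLift`) took two displayed hypotheses, `hcomp` (transitivity of `Cor` on the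
triples level/layer/layer vs level/level/layer) and `hint` (integrality of corestricted classes). With
`coresLe_comp` (file `GaloisRepresentations/ContinuousCorestrictionComp`) the first one is a theorem
(`levelToLayer_layerCores_comm`); this file records the lift with `hint` alone. Nothing else is assumed;
no named fact is minted.

References: K. Kato, Astérisque 295 (2004) §12.2, §13.1, Thm. 13.4 [Kato2004Asterisque];
Neukirch–Schmidt–Wingberg (2008) (1.5.3)–(1.5.6) [NeukirchSchmidtWingberg2008].
-/

noncomputable section

open scoped NumberField
open Field IsDedekindDomain
open Literature.NumberTheory.GaloisRepresentations
open Literature.NumberTheory.EllipticCurves Literature.NumberTheory.EllipticCurves.Kato2004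
open Literature.NumberTheory.EllipticCurves.Kato2004.EulerSystemValues

namespace Literature.NumberTheory.EllipticCurves.Kato2004

variable (W : WeierstrassCurve ℚ) [W.IsElliptic] (p : ℕ) [Fact p.Prime]
  [ContinuousSMul ℤ_[p] (W.tateModule p)] {κ : ZpExtension ℚ p} (hκ : κ.IsCyclotomic) (hp : p ≠ 2)

/-- **The two corestriction routes from `ℚ(μ_{p^{n+2}})` to `ℚ_n` agree**:
`Cor_{ℚ_{n+1}/ℚ_n} ∘ Cor_{ℚ(μ_{p^{n+2}})/ℚ_{n+1}} = Cor_{ℚ(μ_{p^{n+1}})/ℚ_n} ∘ Cor_{ℚ(μ_{p^{n+2}})/ℚ(μ_{p^{n+1}})}`,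
both being `Cor_{ℚ(μ_{p^{n+2}})/ℚ_n}` by transitivity of corestriction (`coresLe_comp`). This is hypothesis
`hcomp` of `IwasawaH1Data.existsUnique_lift_of_isEulerSystem`. [cite: NeukirchSchmidtWingberg2008, I §5 (1.5.3)–(1.5.6)] -/
theorem levelToLayer_layerCores_comm (S : Set (HeightOneSpectrum (𝓞 ℚ))) (n : ℕ)
    (x : H1 (tateRep W p) ((cyclotomicLevelsRat p S).level (n + 2) ∅)) :
    layerCores (tateRep W p) κ n (levelToLayer W p hκ hp S (n + 1) x) =
      levelToLayer W p hκ hp S n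
        ((cyclotomicLevelsRat p S).coresP (tateRep W p) (Nat.le_succ (n + 1)) ∅ x) := by
  -- the finite-index instances for the composite `Gal(ℚ̄/ℚ(μ_{p^{n+2}})) ≤ Gal(ℚ̄/ℚ_n)`
  haveI : ((cyclotomicLevelsRat p S).level (n + 2) ∅).FiniteIndex :=
    finiteIndex_of_isOpen_of_compactSpace _ ((cyclotomicLevelsRat p S).isOpen_level (n + 2) ∅)
  haveI : ((cyclotomicLevelsRat p S).level (n + 1) ∅).FiniteIndex :=
    finiteIndex_of_isOpen_of_compactSpace _ ((cyclotomicLevelsRat p S).isOpen_level (n + 1) ∅)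
  haveI : (κ.layerSubgroup (n + 1)).FiniteIndex :=
    finiteIndex_of_isOpen_of_compactSpace _ (κ.isOpen_layerSubgroup (n + 1))
  haveI : Fintype (κ.layerSubgroup n ⧸
      ((cyclotomicLevelsRat p S).level (n + 2) ∅).subgroupOf (κ.layerSubgroup n)) := Fintype.ofFinite _
  haveI : Fintype (κ.layerSubgroup (n + 1) ⧸
      ((cyclotomicLevelsRat p S).level (n + 2) ∅).subgroupOf (κ.layerSubgroup (n + 1))) :=
    Fintype.ofFinite _
  haveI : Fintype (κ.layerSubgroup n ⧸ (κ.layerSubgroup (n + 1)).subgroupOf (κ.layerSubgroup n)) :=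
    Fintype.ofFinite _
  haveI : Fintype (κ.layerSubgroup n ⧸
      ((cyclotomicLevelsRat p S).level (n + 1) ∅).subgroupOf (κ.layerSubgroup n)) := Fintype.ofFinite _
  haveI : Fintype ((cyclotomicLevelsRat p S).level (n + 1) ∅ ⧸
      ((cyclotomicLevelsRat p S).level (n + 2) ∅).subgroupOf ((cyclotomicLevelsRat p S).level (n + 1) ∅)) :=
    Fintype.ofFinite _
  have h₁ : (cyclotomicLevelsRat p S).level (n + 2) ∅ ≤ κ.layerSubgroup (n + 1) :=
    hκ.cyclotomicLevelsRat_level_succ_le_layerSubgroup hp S (n + 1)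
  have h₁' : κ.layerSubgroup (n + 1) ≤ κ.layerSubgroup n := κ.layerSubgroup_antitone (Nat.le_succ n)
  have h₂ : (cyclotomicLevelsRat p S).level (n + 2) ∅ ≤ (cyclotomicLevelsRat p S).level (n + 1) ∅ :=
    (cyclotomicLevelsRat p S).level_mono_left (Nat.le_succ (n + 1)) ∅
  have h₂' : (cyclotomicLevelsRat p S).level (n + 1) ∅ ≤ κ.layerSubgroup n :=
    hκ.cyclotomicLevelsRat_level_succ_le_layerSubgroup hp S n
  have hV := (cyclotomicLevelsRat p S).isOpen_level (n + 2) ∅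
  -- route 1: level (n+2) → layer (n+1) → layer n;  route 2: level (n+2) → level (n+1) → layer n
  have r₁ := LinearMap.congr_fun
    (coresLe_comp (tateRep W p).toTopRep h₁ h₁' hV (κ.isOpen_layerSubgroup (n + 1))) x
  have r₂ := LinearMap.congr_fun
    (coresLe_comp (tateRep W p).toTopRep h₂ h₂' hV ((cyclotomicLevelsRat p S).isOpen_level (n + 1) ∅)) x
  rw [LinearMap.comp_apply] at r₁ r₂
  unfold layerCores levelToLayer EulerSystemLevels.coresP
  -- the two sides are the two routes; `Fintype` instances are subsingletons (closed by `convert`)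
  convert r₁.trans r₂.symm using 5

variable {γ : absoluteGaloisGroup ℚ} (I : IwasawaH1Data W p κ γ)

/-- **The Λ-adic class of the `p`-power levels of an Euler system, with only INTEGRALITY displayed.**
For an Euler system `z` for `T_pW` on the levels of `cyclotomicLevelsRat p S` (`p` odd, `κ` cyclotomic),
GRANTED that the corestricted classes `Cor_{ℚ(μ_{p^{n+1}})/ℚ_n}(z_{n+1,∅})` are integral (`hint` —
functoriality of `H¹(O[1/p], ·)` under corestriction, Kato §8.2; not yet a tree theorem), there is a
UNIQUE `𝐲 ∈ 𝐇¹_Γ(T_pW)` with `proj n 𝐲 = Cor(z_{n+1,∅})` for all `n` (Kato §13.1 / Thm. 13.4, "`Z` …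
generated by `(z_{p^n})_n`"); the norm-compatibility is now a THEOREM (`levelToLayer_layerCores_comm` +
`IsEulerSystem.cores_p`). [cite: Kato2004Asterisque, §13.1 and Thm. 13.4 (pp. 224–226), §12.2 (p. 220)] -/
theorem IwasawaH1Data.existsUnique_lift_of_isEulerSystem_of_integral
    [Module.Free ℤ_[p] (W.tateModule p)] [Module.Finite ℤ_[p] (W.tateModule p)]
    (S : Set (HeightOneSpectrum (𝓞 ℚ)))
    (z : ∀ (k : ℕ) (r : (cyclotomicLevelsRat p S).Ideals),
      H1 (tateRep W p) ((cyclotomicLevelsRat p S).level k r.1))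
    (hz : IsEulerSystem (cyclotomicLevelsRat p S) (tateRep W p) p z)
    (hint : ∀ n : ℕ, levelToLayer W p hκ hp S n (z (n + 1) (cyclotomicLevelsRat p S).idealOne) ∈
      integralH1 (tateRep W p) p (κ.layerSubgroup n)) :
    ∃! y : I.H, ∀ n : ℕ,
      I.proj n y = levelToLayer W p hκ hp S n (z (n + 1) (cyclotomicLevelsRat p S).idealOne) :=
  IwasawaH1Data.existsUnique_lift_of_isEulerSystem W p hκ hp I S z hz
    (fun n x ↦ levelToLayer_layerCores_comm W p hκ hp S n x) hint

end Literature.NumberTheory.EllipticCurves.Kato2004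

end
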